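import Literature.NumberTheory.Sieve.BombieriFriedlanderIwaniecTheorem7Poisson
import HarnessLib

/-!
# Bombieri–Friedlander–Iwaniec 1986, Theorem 7 (§14) — the sum over arbitrary sets of `l` and `r`

Topic `Literature/NumberTheory/Sieve`; continuation of `…Theorem7Weights` / `…Theorem7Poisson`.
The sum `Δ` of §14 is needed with the OUTER variables `l` and `r` running over arbitrary finite
sets `SL`, `SR` (not only over full dyadic ranges): when a short range of `n` is absorbed into `l`
(`l' = ln`) or a short range of `q` into the modulus (`k = qr`), the new outer variables run over
the sparse sets `n · (l ∼ L)`, `q · (r ∼ R)`; in Lemma 1 the outer variables only index the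
arbitrary coefficients `B`, so nothing is lost, while enlarging the sparse sets to full dyadic
ranges would lose the factors `n`, `q` in all error terms.  This file re-proves, for
`BFI.tripleTS a Xm Xn Xq α β γ SL SR = ∑_{r ∈ SR, (r,a)=1} ∑_{l ∈ SL, (l,r)=1} |qSumT(r, l)|`, the
elementary estimates of `…Theorem7Weights` (subadditivity, thin weights, smoothing) and the
Poisson step of `…Theorem7Poisson`, with `#SL` in place of `2L + 1`.  Everything here is PROVED;
no named fact is introduced.

## References

* E. Bombieri, J. B. Friedlander, H. Iwaniec, Acta Math. 156 (1986), 203–251: §14 pp. 244–245.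
  [BombieriFriedlanderIwaniecActa1986]
-/

noncomputable section

open Finset Real
open scoped ArithmeticFunction.sigma

namespace Literature.NumberTheory.Sieve

namespace BFI

/-! ### `Δ` over arbitrary sets of `l`, `r` -/

/-- **The sum `Δ` of §14 with weights, over sets `SL`, `SR` of `l`, `r`**:
`∑_{r ∈ SR, (r,a)=1} ∑_{l ∈ SL, (l,r)=1} |∑_{q ≤ Xq, (q,al)=1} γ(q) (count − expected)|`.
[cite: BombieriFriedlanderIwaniecActa1986, §14 (14.1) p. 244] -/
def tripleTS (a : ℤ) (Xm Xn Xq : ℕ) (α β γ : ℕ → ℝ) (SL SR : Finset ℕ) : ℝ :=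
  ∑ r ∈ SR.filter (fun r : ℕ => IsCoprime (r : ℤ) a),
    ∑ l ∈ SL.filter (fun l : ℕ => l.Coprime r), |qSumT a Xm Xn Xq α β γ r l|

/-- `tripleT` is `tripleTS` on dyadic ranges. [folklore] -/
theorem tripleT_eq_tripleTS (a : ℤ) (Xm Xn Xq : ℕ) (α β γ : ℕ → ℝ) (L R : ℝ) :
    tripleT a Xm Xn Xq α β γ L R = tripleTS a Xm Xn Xq α β γ (dyadic L) (dyadic R) := rfl

/-- `Δ ≥ 0`. [folklore] -/
theorem tripleTS_nonneg (a : ℤ) (Xm Xn Xq : ℕ) (α β γ : ℕ → ℝ) (SL SR : Finset ℕ) :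
    0 ≤ tripleTS a Xm Xn Xq α β γ SL SR :=
  Finset.sum_nonneg fun _ _ => Finset.sum_nonneg fun _ _ => abs_nonneg _

/-- Monotonicity in the sets `SL`, `SR`. [folklore] -/
theorem tripleTS_mono (a : ℤ) (Xm Xn Xq : ℕ) (α β γ : ℕ → ℝ) {SL SL' SR SR' : Finset ℕ}
    (hL : SL ⊆ SL') (hR : SR ⊆ SR') :
    tripleTS a Xm Xn Xq α β γ SL SR ≤ tripleTS a Xm Xn Xq α β γ SL' SR' := by
  unfold tripleTS
  refine (Finset.sum_le_sum_of_subset_of_nonneg (Finset.filter_subset_filter _ hR) fun r _ _ =>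
    Finset.sum_nonneg fun l _ => abs_nonneg _).trans ?_
  exact Finset.sum_le_sum fun r _ => Finset.sum_le_sum_of_subset_of_nonneg
    (Finset.filter_subset_filter _ hL) fun l _ _ => abs_nonneg _

/-- **For `z ≤ 2`, `deltaStarSets` is `tripleTS` with indicator weights** (any sets `SL, SR`).
[folklore] -/
theorem deltaStarSets_eq_tripleTS {z : ℝ} (hz : z ≤ 2) (a : ℤ) {Xm Xn Xq : ℕ} {SM SN SQ : Finset ℕ}
    (hM : SM ⊆ Icc 1 Xm) (hN : SN ⊆ Icc 1 Xn) (hQ : SQ ⊆ Icc 1 Xq) (SL SR : Finset ℕ) :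
    deltaStarSets a z SM SN SL SQ SR = tripleTS a Xm Xn Xq (ind SM) (ind SN) (ind SQ) SL SR := by
  unfold deltaStarSets tripleTS
  refine Finset.sum_congr rfl fun r _ => Finset.sum_congr rfl fun l _ => ?_
  rw [roughIndicator_of_le_two hz, one_mul]
  congr 1
  unfold setQSum qSumT
  symm
  rw [← Finset.sum_subset (Finset.filter_subset_filter _ hQ)]
  · refine Finset.sum_congr rfl fun q hq => ?_
    rw [ind_of_mem (Finset.mem_filter.1 hq).1, one_mul]
    unfold bracketT setCongrCount setCoprimeCount congrW coprW
    simp only [roughIndicator_of_le_two hz, mul_one]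
    rw [sum_sum_ite_ind_eq hM hN, sum_sum_ite_ind_eq hM hN]
  · intro q hq hq'
    have hqS : q ∉ SQ := fun h => hq' (Finset.mem_filter.2 ⟨h, (Finset.mem_filter.1 hq).2⟩)
    rw [ind_of_not_mem hqS, zero_mul]

/-- Subadditivity pattern over sets. [folklore] -/
private theorem sum_sum_abs_sub_le' {SR : Finset ℕ} {SL : ℕ → Finset ℕ} (f g : ℕ → ℕ → ℝ) :
    ∑ r ∈ SR, ∑ l ∈ SL r, |f r l - g r l| ≤
      ∑ r ∈ SR, ∑ l ∈ SL r, |f r l| + ∑ r ∈ SR, ∑ l ∈ SL r, |g r l| := by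
  rw [← Finset.sum_add_distrib]
  refine Finset.sum_le_sum fun r _ => ?_
  rw [← Finset.sum_add_distrib]
  exact Finset.sum_le_sum fun l _ => abs_sub _ _

/-- Subadditivity in `α`. [folklore] -/
theorem tripleTS_sub_le_alpha (a : ℤ) (Xm Xn Xq : ℕ) (α₁ α₂ β γ : ℕ → ℝ) (SL SR : Finset ℕ) :
    tripleTS a Xm Xn Xq (α₁ - α₂) β γ SL SR ≤
      tripleTS a Xm Xn Xq α₁ β γ SL SR + tripleTS a Xm Xn Xq α₂ β γ SL SR := by
  unfold tripleTS
  simp only [qSumT_sub_alpha]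
  exact sum_sum_abs_sub_le' _ _

/-- Subadditivity in `β`. [folklore] -/
theorem tripleTS_sub_le_beta (a : ℤ) (Xm Xn Xq : ℕ) (α β₁ β₂ γ : ℕ → ℝ) (SL SR : Finset ℕ) :
    tripleTS a Xm Xn Xq α (β₁ - β₂) γ SL SR ≤
      tripleTS a Xm Xn Xq α β₁ γ SL SR + tripleTS a Xm Xn Xq α β₂ γ SL SR := by
  unfold tripleTS
  simp only [qSumT_sub_beta]
  exact sum_sum_abs_sub_le' _ _

/-- Subadditivity in `γ`. [folklore] -/
theorem tripleTS_sub_le_gamma (a : ℤ) (Xm Xn Xq : ℕ) (α β γ₁ γ₂ : ℕ → ℝ) (SL SR : Finset ℕ) :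
    tripleTS a Xm Xn Xq α β (γ₁ - γ₂) SL SR ≤
      tripleTS a Xm Xn Xq α β γ₁ SL SR + tripleTS a Xm Xn Xq α β γ₂ SL SR := by
  unfold tripleTS
  simp only [qSumT_sub_gamma]
  exact sum_sum_abs_sub_le' _ _

/-- **`Δ` is symmetric in the two smoothed variables `m`, `n`.** [folklore] -/
theorem tripleTS_swap (a : ℤ) (Xm Xn Xq : ℕ) (α β γ : ℕ → ℝ) (SL SR : Finset ℕ) :
    tripleTS a Xm Xn Xq α β γ SL SR = tripleTS a Xn Xm Xq β α γ SL SR := by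
  unfold tripleTS qSumT bracketT
  simp only [congrW_swap a Xm Xn α β, coprW_swap Xm Xn α β]

/-- **The smoothing split** over sets: with `α, β, γ` any weights,
`Δ(1_M, 1_N, 1_Q) ≤ Δ(α, β, γ) + Δ(α − 1_M, 1_N, 1_Q) + Δ(α, β − 1_N, 1_Q) + Δ(α, β, γ − 1_Q)`.
[cite: BombieriFriedlanderIwaniecActa1986, §14 p. 244] -/
theorem tripleTS_indicator_le_split (a : ℤ) (Xm Xn Xq : ℕ) (α β γ : ℕ → ℝ) (SM SN SQ SL SR : Finset ℕ) :
    tripleTS a Xm Xn Xq (ind SM) (ind SN) (ind SQ) SL SR ≤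
      tripleTS a Xm Xn Xq α β γ SL SR + tripleTS a Xm Xn Xq (α - ind SM) (ind SN) (ind SQ) SL SR +
        tripleTS a Xm Xn Xq α (β - ind SN) (ind SQ) SL SR + tripleTS a Xm Xn Xq α β (γ - ind SQ) SL SR := by
  have h1 := tripleTS_sub_le_alpha a Xm Xn Xq α (α - ind SM) (ind SN) (ind SQ) SL SR
  have h2 := tripleTS_sub_le_beta a Xm Xn Xq α β (β - ind SN) (ind SQ) SL SR
  have h3 := tripleTS_sub_le_gamma a Xm Xn Xq α β γ (γ - ind SQ) SL SR
  rw [sub_sub_cancel] at h1 h2 h3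
  linarith

/-! ### Trivial bounds over sets -/

/-- Dropping the filters and `|γ| ≤ 1`: `Δ ≤ ∑_{r ∈ SR} ∑_{l ∈ SL} ∑_{q ≤ Xq} (|congrW| + |coprW|/φ)`.
[folklore] -/
theorem tripleTS_le_sum_abs (a : ℤ) (Xm Xn Xq : ℕ) (α β : ℕ → ℝ) {γ : ℕ → ℝ} (hγ : ∀ q, |γ q| ≤ 1)
    (SL SR : Finset ℕ) :
    tripleTS a Xm Xn Xq α β γ SL SR ≤
      ∑ r ∈ SR, ∑ l ∈ SL, ∑ q ∈ Icc 1 Xq,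
        (|congrW a Xm Xn α β l (q * r)| + |coprW Xm Xn α β (q * r)| / (Nat.totient (q * r) : ℝ)) := by
  have h := tripleT_le_sum_abs a Xm Xn Xq α β hγ
  -- the dyadic proof applies verbatim; we redo it over sets
  unfold tripleTS
  calc _ ≤ ∑ r ∈ SR, ∑ l ∈ SL.filter (fun l : ℕ => l.Coprime r), |qSumT a Xm Xn Xq α β γ r l| :=
        Finset.sum_le_sum_of_subset_of_nonneg (Finset.filter_subset _ _) fun r _ _ =>
          Finset.sum_nonneg fun l _ => abs_nonneg _
    _ ≤ ∑ r ∈ SR, ∑ l ∈ SL, |qSumT a Xm Xn Xq α β γ r l| :=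
        Finset.sum_le_sum fun r _ => Finset.sum_le_sum_of_subset_of_nonneg (Finset.filter_subset _ _)
          fun l _ _ => abs_nonneg _
    _ ≤ _ := Finset.sum_le_sum fun r _ => Finset.sum_le_sum fun l _ => ?_
  unfold qSumT
  calc |∑ q ∈ (Icc 1 Xq).filter (fun q : ℕ => IsCoprime (q : ℤ) (a * l)), γ q * bracketT a Xm Xn α β l (q * r)|
      ≤ ∑ q ∈ (Icc 1 Xq).filter (fun q : ℕ => IsCoprime (q : ℤ) (a * l)),
          |γ q * bracketT a Xm Xn α β l (q * r)| := Finset.abs_sum_le_sum_abs _ _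
    _ ≤ ∑ q ∈ Icc 1 Xq, |γ q * bracketT a Xm Xn α β l (q * r)| :=
        Finset.sum_le_sum_of_subset_of_nonneg (Finset.filter_subset _ _) fun q _ _ => abs_nonneg _
    _ ≤ _ := Finset.sum_le_sum fun q _ => ?_
  rw [abs_mul]
  calc |γ q| * |bracketT a Xm Xn α β l (q * r)| ≤ 1 * |bracketT a Xm Xn α β l (q * r)| :=
        mul_le_mul_of_nonneg_right (hγ q) (abs_nonneg _)
    _ = |congrW a Xm Xn α β l (q * r) - coprW Xm Xn α β (q * r) / (Nat.totient (q * r) : ℝ)| := by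
        rw [one_mul]; rfl
    _ ≤ |congrW a Xm Xn α β l (q * r)| + |coprW Xm Xn α β (q * r) / (Nat.totient (q * r) : ℝ)| :=
        abs_sub _ _
    _ = _ := by rw [abs_div, Nat.abs_cast]

/-- `∑_{r ≤ Xr} ∑_{q ≤ Xq} 1/φ(qr) ≤ (1 + log Xq)² (1 + log Xr)²`. [folklore] -/
theorem sum_Icc_sum_Icc_inv_totient_le (Xr Xq : ℕ) :
    ∑ r ∈ Icc 1 Xr, ∑ q ∈ Icc 1 Xq, ((Nat.totient (q * r) : ℝ))⁻¹ ≤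
      (1 + Real.log Xq) ^ 2 * (1 + Real.log Xr) ^ 2 := by
  have hφ : ∀ q r : ℕ, 1 ≤ q → 1 ≤ r →
      ((Nat.totient (q * r) : ℝ))⁻¹ ≤ ((Nat.totient q : ℝ))⁻¹ * ((Nat.totient r : ℝ))⁻¹ := by
    intro q r hq hr
    have hq0 : (0 : ℝ) < Nat.totient q := by exact_mod_cast Nat.totient_pos.2 hq
    have hr0 : (0 : ℝ) < Nat.totient r := by exact_mod_cast Nat.totient_pos.2 hr
    rw [← mul_inv, inv_le_inv₀ (by exact_mod_cast Nat.totient_pos.2 (Nat.mul_pos hq hr)) (mul_pos hq0 hr0)]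
    exact_mod_cast Nat.totient_super_multiplicative q r
  calc ∑ r ∈ Icc 1 Xr, ∑ q ∈ Icc 1 Xq, ((Nat.totient (q * r) : ℝ))⁻¹
      ≤ ∑ r ∈ Icc 1 Xr, ∑ q ∈ Icc 1 Xq, ((Nat.totient q : ℝ))⁻¹ * ((Nat.totient r : ℝ))⁻¹ := by
        refine Finset.sum_le_sum fun r hr => Finset.sum_le_sum fun q hq => ?_
        exact hφ q r (Finset.mem_Icc.1 hq).1 (Finset.mem_Icc.1 hr).1
    _ = (∑ q ∈ Icc 1 Xq, ((Nat.totient q : ℝ))⁻¹) * ∑ r ∈ Icc 1 Xr, ((Nat.totient r : ℝ))⁻¹ := by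
        rw [Finset.sum_mul_sum, Finset.sum_comm]
    _ ≤ (1 + Real.log Xq) ^ 2 * (1 + Real.log Xr) ^ 2 :=
        mul_le_mul (totientInvSum_le Xq) (totientInvSum_le _)
          (Finset.sum_nonneg fun r _ => inv_nonneg.2 (Nat.cast_nonneg _)) (by positivity)

/-- **The trivial bound for a thin weight `α`, over sets**: if `|α| ≤ 1` is supported on a set `T`
of integers `m > a`, `|β|, |γ| ≤ 1`, `SL ⊆ [1, Xl]`, `SR ⊆ [1, Xr]` and all sizes are `≤ X`, then
`Δ(α, β, γ) ≤ C_δ X^δ · #T · #SL · Xn`. [cite: BombieriFriedlanderIwaniecActa1986, §14 (14.3) p. 245] -/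
theorem tripleTS_le_of_thin_alpha {δ : ℝ} (hδ : 0 < δ) :
    ∃ C : ℝ, 0 < C ∧ ∀ (a : ℤ) (Xm Xn Xq Xl Xr : ℕ) (T SL SR : Finset ℕ) (α β γ : ℕ → ℝ) (X : ℝ),
      1 ≤ X → (Xm : ℝ) ≤ X → (Xn : ℝ) ≤ X → (Xq : ℝ) ≤ X → (Xl : ℝ) ≤ X → (Xr : ℝ) ≤ X →
      SL ⊆ Icc 1 Xl → SR ⊆ Icc 1 Xr → |(a : ℝ)| ≤ X → (∀ m ∈ T, a < (m : ℤ)) →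
      (∀ m, |α m| ≤ 1) → (∀ m, α m ≠ 0 → m ∈ T) → (∀ n, |β n| ≤ 1) → (∀ q, |γ q| ≤ 1) →
      tripleTS a Xm Xn Xq α β γ SL SR ≤ C * X ^ δ * T.card * SL.card * Xn := by
  obtain ⟨Cσ, hCσ, hσ⟩ := sigma_zero_sq_le_rpow hδ
  obtain ⟨Cl, hCl, hlog⟩ := one_add_log_pow_four_le hδ
  refine ⟨Cσ + Cl, by positivity, ?_⟩
  intro a Xm Xn Xq Xl Xr T SL SR α β γ X hX hXm hXn hXq hXl hXr hSL hSR haX hTa hα hαT hβ hγ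
  have hX0 : 0 < X := by linarith
  refine (tripleTS_le_sum_abs a Xm Xn Xq α β hγ SL SR).trans ?_
  rw [show ∑ r ∈ SR, ∑ l ∈ SL, ∑ q ∈ Icc 1 Xq,
        (|congrW a Xm Xn α β l (q * r)| + |coprW Xm Xn α β (q * r)| / (Nat.totient (q * r) : ℝ)) =
      (∑ r ∈ SR, ∑ l ∈ SL, ∑ q ∈ Icc 1 Xq, |congrW a Xm Xn α β l (q * r)|) +
        ∑ r ∈ SR, ∑ l ∈ SL, ∑ q ∈ Icc 1 Xq, |coprW Xm Xn α β (q * r)| / (Nat.totient (q * r) : ℝ) by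
    simp only [Finset.sum_add_distrib]]
  set TM : Finset ℕ := (Icc 1 Xm).filter (· ∈ T) with hTM
  have hTMcard : (TM.card : ℝ) ≤ T.card := by
    exact_mod_cast Finset.card_le_card fun m hm => (Finset.mem_filter.1 hm).2
  -- Step 1: the congruence part
  have hA : ∑ r ∈ SR, ∑ l ∈ SL, ∑ q ∈ Icc 1 Xq, |congrW a Xm Xn α β l (q * r)| ≤
      Cσ * X ^ δ * T.card * SL.card * Xn := by
    have hone : ∀ l ∈ SL, ∀ m ∈ TM, ∀ n ∈ Icc 1 Xn,
        ∑ r ∈ SR, ∑ q ∈ Icc 1 Xq,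
            (if ((q * r : ℕ) : ℤ) ∣ ((l * m * n : ℕ) : ℤ) - a then (1 : ℝ) else 0) ≤ Cσ * X ^ δ := by
      intro l hl m hm n hn
      have hl' := Finset.mem_Icc.1 (hSL hl)
      have hmT : m ∈ T := (Finset.mem_filter.1 hm).2
      have hmX : m ≤ Xm := (Finset.mem_Icc.1 (Finset.mem_filter.1 hm).1).2
      have hn1 : 1 ≤ n := (Finset.mem_Icc.1 hn).1
      have hnX : n ≤ Xn := (Finset.mem_Icc.1 hn).2
      set K : ℤ := ((l * m * n : ℕ) : ℤ) - a with hK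
      have hKpos : 0 < K := by
        have h1 : (m : ℤ) ≤ ((l * m * n : ℕ) : ℤ) := by
          have : m ≤ l * m * n := by
            calc m = 1 * m * 1 := by ring
              _ ≤ l * m * n := Nat.mul_le_mul (Nat.mul_le_mul hl'.1 le_rfl) hn1
          exact_mod_cast this
        have := hTa m hmT
        rw [hK]; linarith
      have hK0 : K ≠ 0 := hKpos.ne'
      have hKle : (K.natAbs : ℝ) ≤ 3 * X ^ 3 := by
        have h2 : ((K.natAbs : ℕ) : ℝ) = (K : ℝ) := by
          rw [Nat.cast_natAbs, abs_of_pos (by exact_mod_cast hKpos)]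
        rw [h2, hK]
        push_cast
        have hlX : (l : ℝ) ≤ X := le_trans (by exact_mod_cast hl'.2) hXl
        have hm' : (m : ℝ) ≤ X := le_trans (by exact_mod_cast hmX) hXm
        have hn' : (n : ℝ) ≤ X := le_trans (by exact_mod_cast hnX) hXn
        have hl0 : (0 : ℝ) ≤ l := Nat.cast_nonneg l
        have hm0 : (0 : ℝ) ≤ m := Nat.cast_nonneg m
        have hn0 : (0 : ℝ) ≤ n := Nat.cast_nonneg n
        have hlm : (l : ℝ) * m ≤ X * X := mul_le_mul hlX hm' hm0 (by positivity)
        have hlmn : (l : ℝ) * m * n ≤ X * X * X := mul_le_mul hlm hn' hn0 (by positivity)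
        have ha' : -(a : ℝ) ≤ X := (neg_le_abs _).trans haX
        have hX3 : X ≤ X * X * X := by nlinarith
        nlinarith
      calc ∑ r ∈ SR, ∑ q ∈ Icc 1 Xq, (if ((q * r : ℕ) : ℤ) ∣ K then (1 : ℝ) else 0)
          ≤ ∑ r ∈ Icc 1 Xr, ∑ q ∈ Icc 1 Xq, (if ((q * r : ℕ) : ℤ) ∣ K then (1 : ℝ) else 0) :=
            Finset.sum_le_sum_of_subset_of_nonneg hSR fun r _ _ =>
              Finset.sum_nonneg fun q _ => by split_ifs <;> norm_num
        _ = ∑ q ∈ Icc 1 Xq, ∑ r ∈ Icc 1 Xr, (if ((q * r : ℕ) : ℤ) ∣ K then (1 : ℝ) else 0) :=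
            Finset.sum_comm
        _ ≤ (σ 0 K.natAbs : ℝ) ^ 2 := by
            have h := sum_sum_dvd_indicator_le Xq Xr K
            rwa [if_neg hK0] at h
        _ ≤ Cσ * X ^ δ := hσ K.natAbs X hX hKle
    calc ∑ r ∈ SR, ∑ l ∈ SL, ∑ q ∈ Icc 1 Xq, |congrW a Xm Xn α β l (q * r)|
        ≤ ∑ r ∈ SR, ∑ l ∈ SL, ∑ q ∈ Icc 1 Xq, ∑ m ∈ TM, ∑ n ∈ Icc 1 Xn,
            (if ((q * r : ℕ) : ℤ) ∣ ((l * m * n : ℕ) : ℤ) - a then (1 : ℝ) else 0) :=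
          Finset.sum_le_sum fun r _ => Finset.sum_le_sum fun l _ => Finset.sum_le_sum fun q _ =>
            abs_congrW_le_of_thin hα hαT hβ a Xm Xn l (q * r)
      _ = ∑ l ∈ SL, ∑ m ∈ TM, ∑ n ∈ Icc 1 Xn, ∑ r ∈ SR, ∑ q ∈ Icc 1 Xq,
            (if ((q * r : ℕ) : ℤ) ∣ ((l * m * n : ℕ) : ℤ) - a then (1 : ℝ) else 0) :=
          sum5_reorder _ _ _ _ _ _
      _ ≤ ∑ l ∈ SL, ∑ m ∈ TM, ∑ _n ∈ Icc 1 Xn, Cσ * X ^ δ :=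
          Finset.sum_le_sum fun l hl => Finset.sum_le_sum fun m hm => Finset.sum_le_sum fun n hn =>
            hone l hl m hm n hn
      _ = (SL.card : ℝ) * (TM.card * (Xn * (Cσ * X ^ δ))) := by
          simp only [Finset.sum_const, Nat.card_Icc, Nat.add_sub_cancel, nsmul_eq_mul]
      _ ≤ (SL.card : ℝ) * (T.card * (Xn * (Cσ * X ^ δ))) := by gcongr
      _ = Cσ * X ^ δ * T.card * SL.card * Xn := by ring
  -- Step 2: the expected part
  have hB : ∑ r ∈ SR, ∑ l ∈ SL, ∑ q ∈ Icc 1 Xq,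
      |coprW Xm Xn α β (q * r)| / (Nat.totient (q * r) : ℝ) ≤ Cl * X ^ δ * T.card * SL.card * Xn := by
    have hlogs : (1 + Real.log Xq) ^ 2 * (1 + Real.log Xr) ^ 2 ≤ Cl * X ^ δ := by
      have h1 : 1 + Real.log Xq ≤ 1 + Real.log (2 * X) :=
        one_add_log_natCast_le (by linarith) (hXq.trans (by linarith))
      have h2 : 1 + Real.log Xr ≤ 1 + Real.log (2 * X) :=
        one_add_log_natCast_le (by linarith) (hXr.trans (by linarith))
      have h01 : 0 ≤ 1 + Real.log (Xq : ℝ) := by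
        rcases Nat.eq_zero_or_pos Xq with h | h
        · simp [h]
        · linarith [Real.log_nonneg (show (1 : ℝ) ≤ Xq by exact_mod_cast h)]
      have h02 : 0 ≤ 1 + Real.log (Xr : ℝ) := by
        rcases Nat.eq_zero_or_pos Xr with h | h
        · simp [h]
        · linarith [Real.log_nonneg (show (1 : ℝ) ≤ Xr by exact_mod_cast h)]
      calc (1 + Real.log Xq) ^ 2 * (1 + Real.log Xr) ^ 2
          ≤ (1 + Real.log (2 * X)) ^ 2 * (1 + Real.log (2 * X)) ^ 2 := by gcongr
        _ = (1 + Real.log (2 * X)) ^ 4 := by ring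
        _ ≤ Cl * X ^ δ := hlog X hX
    calc ∑ r ∈ SR, ∑ l ∈ SL, ∑ q ∈ Icc 1 Xq, |coprW Xm Xn α β (q * r)| / (Nat.totient (q * r) : ℝ)
        ≤ ∑ r ∈ SR, ∑ _l ∈ SL, ∑ q ∈ Icc 1 Xq, (T.card : ℝ) * Xn * ((Nat.totient (q * r) : ℝ))⁻¹ := by
          refine Finset.sum_le_sum fun r _ => Finset.sum_le_sum fun l _ => Finset.sum_le_sum fun q _ => ?_
          rw [div_eq_mul_inv]
          exact mul_le_mul_of_nonneg_right (abs_coprW_le_of_thin hα hαT hβ Xm Xn (q * r))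
            (inv_nonneg.2 (Nat.cast_nonneg _))
      _ = (SL.card : ℝ) * ((T.card : ℝ) * Xn * ∑ r ∈ SR, ∑ q ∈ Icc 1 Xq, ((Nat.totient (q * r) : ℝ))⁻¹) := by
          simp_rw [Finset.mul_sum]
          refine Finset.sum_congr rfl fun r _ => ?_
          rw [Finset.sum_const, nsmul_eq_mul, Finset.mul_sum]
      _ ≤ (SL.card : ℝ) * ((T.card : ℝ) * Xn * (Cl * X ^ δ)) := by
          have h0 : 0 ≤ ∑ r ∈ SR, ∑ q ∈ Icc 1 Xq, ((Nat.totient (q * r) : ℝ))⁻¹ :=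
            Finset.sum_nonneg fun r _ => Finset.sum_nonneg fun q _ => inv_nonneg.2 (Nat.cast_nonneg _)
          have hsub : ∑ r ∈ SR, ∑ q ∈ Icc 1 Xq, ((Nat.totient (q * r) : ℝ))⁻¹ ≤
              ∑ r ∈ Icc 1 Xr, ∑ q ∈ Icc 1 Xq, ((Nat.totient (q * r) : ℝ))⁻¹ :=
            Finset.sum_le_sum_of_subset_of_nonneg hSR fun r _ _ =>
              Finset.sum_nonneg fun q _ => inv_nonneg.2 (Nat.cast_nonneg _)
          gcongr
          exact hsub.trans ((sum_Icc_sum_Icc_inv_totient_le Xr Xq).trans hlogs)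
      _ = Cl * X ^ δ * T.card * SL.card * Xn := by ring
  calc _ ≤ Cσ * X ^ δ * T.card * SL.card * Xn + Cl * X ^ δ * T.card * SL.card * Xn := add_le_add hA hB
    _ = (Cσ + Cl) * X ^ δ * T.card * SL.card * Xn := by ring

/-- The number of pairs `(m, n)`, `m ≤ Xm`, `n ≤ Xn`, with `mn = k ≠ 0` is at most `τ(k)`. [folklore] -/
theorem card_pairs_mul_eq_le {k : ℕ} (hk : k ≠ 0) (IM IN : Finset ℕ) :
    ((IM ×ˢ IN).filter (fun p : ℕ × ℕ => p.1 * p.2 = k)).card ≤ k.divisors.card := by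
  refine Finset.card_le_card_of_injOn (fun p => p.1) (fun p hp => ?_) ?_
  · rw [Finset.coe_filter] at hp
    exact Finset.mem_coe.2 (Nat.mem_divisors.2 ⟨⟨p.2, hp.2.symm⟩, hk⟩)
  · intro p₁ hp₁ p₂ hp₂ h
    rw [Finset.coe_filter] at hp₁ hp₂
    have h1 : p₁.1 ≠ 0 := fun h0 => hk (by rw [← hp₁.2, h0, zero_mul])
    have h2 : p₁.2 = p₂.2 := by
      apply Nat.eq_of_mul_eq_mul_left (Nat.pos_of_ne_zero h1)
      rw [hp₁.2, show p₁.1 = p₂.1 from h, hp₂.2]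
    exact Prod.ext h h2

/-- **Counting `(m, n)` with `lmn ≡ a (mod d)` for ONE `l`**, `(l, d) = 1`, `(a, d) = 1`: at most
`C_δ X^δ (Xm Xn / d + 1)` (through `k = mn`: `τ(k)` pairs per `k`, `≤ XmXn/d + 1` values of `k` in the
class `a l̄`). [folklore] -/
theorem sum_pair_congr_indicator_le {δ : ℝ} (hδ : 0 < δ) :
    ∃ C : ℝ, 0 < C ∧ ∀ (a : ℤ) (Xm Xn : ℕ) (X : ℝ) (l d : ℕ), 1 ≤ X → (Xm : ℝ) ≤ X → (Xn : ℝ) ≤ X →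
      0 < d → l.Coprime d →
      ∑ m ∈ Icc 1 Xm, ∑ n ∈ Icc 1 Xn,
          (if ((l * m * n : ℕ) : ZMod d) = (a : ZMod d) then (1 : ℝ) else 0) ≤
        C * X ^ δ * ((Xm * Xn : ℕ) / (d : ℝ) + 1) := by
  classical
  obtain ⟨Cσ, hCσ, hσ⟩ := sigma_zero_sq_le_rpow hδ
  refine ⟨Cσ, hCσ, fun a Xm Xn X l d hX hXm hXn hd hl => ?_⟩
  have hX0 : 0 < X := by linarith
  haveI : NeZero d := ⟨hd.ne'⟩
  -- the class of `mn`
  set c : ZMod d := (a : ZMod d) * ((l : ZMod d))⁻¹ with hc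
  have hiff : ∀ m n : ℕ, ((l * m * n : ℕ) : ZMod d) = (a : ZMod d) ↔ ((m * n : ℕ) : ZMod d) = c := by
    intro m n
    have hu : (l : ZMod d) * ((l : ZMod d))⁻¹ = 1 := ZMod.coe_mul_inv_eq_one l hl
    rw [show l * m * n = (m * n) * l by ring, Nat.cast_mul]
    constructor
    · intro h; rw [hc, ← h, mul_assoc, hu, mul_one]
    · intro h; rw [h, hc, mul_assoc, mul_comm ((l : ZMod d))⁻¹, hu, mul_one]
  set f : ℕ → ℝ := fun k => if ((k : ℕ) : ZMod d) = c then (1 : ℝ) else 0 with hf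
  have hf0 : ∀ k, 0 ≤ f k := fun k => by simp only [hf]; split_ifs <;> norm_num
  set P : Finset (ℕ × ℕ) := Icc 1 Xm ×ˢ Icc 1 Xn with hP
  have hbox : ∑ m ∈ Icc 1 Xm, ∑ n ∈ Icc 1 Xn,
      (if ((l * m * n : ℕ) : ZMod d) = (a : ZMod d) then (1 : ℝ) else 0) = ∑ p ∈ P, f (p.1 * p.2) := by
    rw [hP, Finset.sum_product]
    refine Finset.sum_congr rfl fun m _ => Finset.sum_congr rfl fun n _ => ?_
    simp only [hf, hiff]
  rw [hbox, Finset.sum_comp f (fun p : ℕ × ℕ => p.1 * p.2)]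
  set K : ℕ := Xm * Xn with hK
  have himage : P.image (fun p : ℕ × ℕ => p.1 * p.2) ⊆ Icc 1 K := by
    intro k hk
    rw [Finset.mem_image] at hk
    obtain ⟨p, hp, rfl⟩ := hk
    rw [hP, Finset.mem_product, Finset.mem_Icc, Finset.mem_Icc] at hp
    rw [Finset.mem_Icc]
    exact ⟨Nat.one_le_iff_ne_zero.2 (Nat.mul_ne_zero (by omega) (by omega)), Nat.mul_le_mul hp.1.2 hp.2.2⟩
  have hfib : ∀ k ∈ P.image (fun p : ℕ × ℕ => p.1 * p.2),
      ((P.filter (fun p : ℕ × ℕ => p.1 * p.2 = k)).card : ℝ) ≤ Cσ * X ^ δ := by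
    intro k hk
    have hk1 := Finset.mem_Icc.1 (himage hk)
    have hk0 : k ≠ 0 := by omega
    have hkX : (k : ℝ) ≤ 3 * X ^ 3 := by
      have h1 : (k : ℝ) ≤ (K : ℝ) := by exact_mod_cast hk1.2
      have h2 : (K : ℝ) ≤ X * X := by rw [hK]; push_cast; exact mul_le_mul hXm hXn (Nat.cast_nonneg _) hX0.le
      nlinarith [mul_nonneg (mul_nonneg hX0.le hX0.le) hX0.le]
    calc ((P.filter (fun p : ℕ × ℕ => p.1 * p.2 = k)).card : ℝ) ≤ (k.divisors.card : ℝ) := by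
          exact_mod_cast card_pairs_mul_eq_le hk0 _ _
      _ ≤ (σ 0 k : ℝ) ^ 2 := by
          have h1 : (1 : ℝ) ≤ (σ 0 k : ℝ) := by exact_mod_cast one_le_sigma_zero hk0
          rw [ArithmeticFunction.sigma_zero_apply] at h1 ⊢
          nlinarith
      _ ≤ Cσ * X ^ δ := hσ k X hX hkX
  have hclass : ∑ k ∈ Icc 1 K, f k ≤ (K : ℝ) / d + 1 := by
    have : ∑ k ∈ Icc 1 K, f k = (((Icc 1 K).filter (fun k : ℕ => (k : ZMod d) = c)).card : ℝ) := by
      rw [Finset.card_eq_sum_ones, Nat.cast_sum, Finset.sum_filter]; push_cast; rfl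
    rw [this]
    exact card_Icc_filter_natCast_eq_le d K c
  calc ∑ k ∈ P.image (fun p : ℕ × ℕ => p.1 * p.2), (P.filter (fun p : ℕ × ℕ => p.1 * p.2 = k)).card • f k
      ≤ ∑ k ∈ P.image (fun p : ℕ × ℕ => p.1 * p.2), Cσ * X ^ δ * f k := by
        refine Finset.sum_le_sum fun k hk => ?_
        rw [nsmul_eq_mul]
        exact mul_le_mul_of_nonneg_right (hfib k hk) (hf0 k)
    _ ≤ ∑ k ∈ Icc 1 K, Cσ * X ^ δ * f k :=
        Finset.sum_le_sum_of_subset_of_nonneg himage fun k _ _ => mul_nonneg (by positivity) (hf0 k)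
    _ = Cσ * X ^ δ * ∑ k ∈ Icc 1 K, f k := by rw [Finset.mul_sum]
    _ ≤ Cσ * X ^ δ * ((K : ℝ) / d + 1) := mul_le_mul_of_nonneg_left hclass (by positivity)

/-- Divisibility form of the per-`l` count: for `(l, d) = 1`, `0 < d`,
`#{(m,n) : d ∣ lmn − a} ≤ C_δ X^δ (XmXn/d + 1)`. [folklore] -/
theorem sum_pair_dvd_indicator_le {δ : ℝ} (hδ : 0 < δ) :
    ∃ C : ℝ, 0 < C ∧ ∀ (a : ℤ) (Xm Xn : ℕ) (X : ℝ) (l d : ℕ), 1 ≤ X → (Xm : ℝ) ≤ X → (Xn : ℝ) ≤ X →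
      0 < d → l.Coprime d →
      ∑ m ∈ Icc 1 Xm, ∑ n ∈ Icc 1 Xn,
          (if (d : ℤ) ∣ ((l * m * n : ℕ) : ℤ) - a then (1 : ℝ) else 0) ≤
        C * X ^ δ * ((Xm * Xn : ℕ) / (d : ℝ) + 1) := by
  obtain ⟨C, hC, h⟩ := sum_pair_congr_indicator_le hδ
  refine ⟨C, hC, fun a Xm Xn X l d hX hXm hXn hd hl => ?_⟩
  convert h a Xm Xn X l d hX hXm hXn hd hl using 4 with m _ n _
  have : (d : ℤ) ∣ ((l * m * n : ℕ) : ℤ) - a ↔ ((l * m * n : ℕ) : ZMod d) = (a : ZMod d) := by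
    rw [← ZMod.intCast_eq_intCast_iff_dvd_sub, Int.cast_natCast, eq_comm]
  simp only [this]

/-- **The trivial bound for a thin weight `γ` on the moduli, over sets**: if `|γ| ≤ 1` is supported
on a set `T` of integers `≥ Q₀ > 0`, `|α|, |β| ≤ 1`, `SL ⊆ [1, Xl]`, `SR ⊆ (R, 2R]`, then
`Δ(α, β, γ) ≤ C_δ X^δ · #SL · (XmXn · #T/Q₀ + #T (2R + 1))` (for each `l`, the pairs `(m, n)` with
`lmn ≡ a (qr)` are counted through `k = mn`). [cite: BombieriFriedlanderIwaniecActa1986, §14 p. 244] -/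
theorem tripleTS_le_of_thin_gamma {δ : ℝ} (hδ : 0 < δ) :
    ∃ C : ℝ, 0 < C ∧ ∀ (a : ℤ) (Xm Xn Xq Xl : ℕ) (T SL SR : Finset ℕ) (α β γ : ℕ → ℝ) (X R Q₀ : ℝ),
      1 ≤ X → (Xm : ℝ) ≤ X → (Xn : ℝ) ≤ X → (Xq : ℝ) ≤ X → (Xl : ℝ) ≤ X → 0 ≤ R → R ≤ X →
      SL ⊆ Icc 1 Xl → SR ⊆ dyadic R → 0 < Q₀ → (∀ q ∈ T, Q₀ ≤ (q : ℝ)) →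
      (∀ m, |α m| ≤ 1) → (∀ n, |β n| ≤ 1) → (∀ q, |γ q| ≤ 1) → (∀ q, γ q ≠ 0 → q ∈ T) →
      tripleTS a Xm Xn Xq α β γ SL SR ≤
        C * X ^ δ * SL.card * (T.card / Q₀ * (Xm * Xn) + T.card * (2 * R + 1)) := by
  obtain ⟨Cp, hCp, hp⟩ := sum_pair_dvd_indicator_le hδ
  obtain ⟨Cσ, hCσ, hσ⟩ := sigma_zero_sq_le_rpow hδ
  refine ⟨2 * Cp + 2 * Cσ, by positivity, ?_⟩
  intro a Xm Xn Xq Xl T SL SR α β γ X R Q₀ hX hXm hXn hXq hXl hR hRX hSL hSR hQ₀ hTQ hα hβ hγ hγT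
  have hX0 : 0 < X := by linarith
  set TQ : Finset ℕ := (Icc 1 Xq).filter (fun q : ℕ => q ∈ T) with hTQdef
  have hTQcard : (TQ.card : ℝ) ≤ T.card := by
    exact_mod_cast Finset.card_le_card
      (fun q (hq : q ∈ (Icc 1 Xq).filter (fun q : ℕ => q ∈ T)) => (Finset.mem_filter.1 hq).2)
  have hSRcard : (SR.card : ℝ) ≤ 2 * R + 1 := by
    have := Finset.card_le_card hSR
    have h2 := card_dyadic_le_two_mul hR
    calc (SR.card : ℝ) ≤ (dyadic R).card := by exact_mod_cast this
      _ ≤ 2 * R + 1 := by linarith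
  -- the reciprocal sums
  have hinvq : ∑ q ∈ TQ, (1 : ℝ) / q ≤ T.card / Q₀ := by
    calc ∑ q ∈ TQ, (1 : ℝ) / q ≤ ∑ _q ∈ TQ, 1 / Q₀ := by
          refine Finset.sum_le_sum fun q hq => ?_
          exact one_div_le_one_div_of_le hQ₀ (hTQ q (Finset.mem_filter.1 hq).2)
      _ = (TQ.card : ℝ) * (1 / Q₀) := by rw [Finset.sum_const, nsmul_eq_mul]
      _ ≤ T.card * (1 / Q₀) := by gcongr
      _ = T.card / Q₀ := by ring
  have hinvr : ∑ r ∈ SR, (1 : ℝ) / r ≤ 2 :=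
    (Finset.sum_le_sum_of_subset_of_nonneg hSR fun r _ _ => by positivity).trans (sum_dyadic_one_div_le_two hR)
  have hinvqr : ∑ r ∈ SR, ∑ q ∈ TQ, (1 : ℝ) / ((q : ℝ) * r) ≤ 2 * (T.card / Q₀) := by
    calc ∑ r ∈ SR, ∑ q ∈ TQ, (1 : ℝ) / ((q : ℝ) * r)
        = (∑ r ∈ SR, (1 : ℝ) / r) * ∑ q ∈ TQ, (1 : ℝ) / q := by
          rw [Finset.sum_mul]
          refine Finset.sum_congr rfl fun r _ => ?_
          rw [Finset.mul_sum]
          refine Finset.sum_congr rfl fun q _ => ?_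
          rw [one_div_mul_one_div, mul_comm (r : ℝ)]
      _ ≤ 2 * (T.card / Q₀) :=
          mul_le_mul hinvr hinvq (Finset.sum_nonneg fun q _ => by positivity) (by norm_num)
  -- the pointwise bound, for filtered triples
  set bd : ℕ → ℕ → ℝ := fun r q =>
    Cp * X ^ δ * (((Xm * Xn : ℕ) : ℝ) * (1 / ((q : ℝ) * r)) + 1) +
      ((Xm : ℝ) * Xn) * (Cσ * X ^ δ * (1 / ((q : ℝ) * r))) with hbd
  have hbd0 : ∀ r q, 0 ≤ bd r q := fun r q => by positivity
  have hστ : ∀ r ∈ SR, ∀ q ∈ TQ, (σ 0 q : ℝ) * (σ 0 r : ℝ) ≤ Cσ * X ^ δ := by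
    intro r hr q hq
    have hr' := (mem_dyadic hR).1 (hSR hr)
    have hq' := (Finset.mem_Icc.1 (Finset.mem_filter.1 hq).1).2
    have hX3 : X ≤ X ^ 3 := by nlinarith [mul_nonneg hX0.le hX0.le]
    have hqX : (q : ℝ) ≤ 3 * X ^ 3 := by
      have : (q : ℝ) ≤ X := le_trans (by exact_mod_cast hq') hXq
      nlinarith
    have hrX : (r : ℝ) ≤ 3 * X ^ 3 := by nlinarith [hr'.2]
    have h1 := hσ q X hX hqX
    have h2 := hσ r X hX hrX
    nlinarith [sq_nonneg ((σ 0 q : ℝ) - (σ 0 r : ℝ))]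
  have hpt : ∀ r ∈ SR.filter (fun r : ℕ => IsCoprime (r : ℤ) a), ∀ l ∈ SL.filter (fun l : ℕ => l.Coprime r),
      ∀ q ∈ TQ.filter (fun q : ℕ => IsCoprime (q : ℤ) (a * l)),
      |congrW a Xm Xn α β l (q * r)| + |coprW Xm Xn α β (q * r)| / (Nat.totient (q * r) : ℝ) ≤ bd r q := by
    intro r hr l hl q hq
    have hr' := Finset.mem_filter.1 hr
    have hl' := Finset.mem_filter.1 hl
    have hq' := Finset.mem_filter.1 hq
    have hrR : r ∈ SR := hr'.1
    have hr0 : 0 < r := pos_of_mem_dyadic hR (hSR hrR)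
    have hq0 : 0 < q := (Finset.mem_Icc.1 (Finset.mem_filter.1 hq'.1).1).1
    have hlqr : l.Coprime (q * r) := by
      refine Nat.Coprime.mul_right ?_ hl'.2
      exact (Nat.isCoprime_iff_coprime.1 (IsCoprime.of_mul_right_right hq'.2)).symm
    refine add_le_add ?_ ?_
    · refine (abs_congrW_le_count hα hβ a Xm Xn l (q * r)).trans ?_
      refine (hp a Xm Xn X l (q * r) hX hXm hXn (Nat.mul_pos hq0 hr0) hlqr).trans (le_of_eq ?_)
      have hqr : ((q * r : ℕ) : ℝ) = (q : ℝ) * r := by push_cast; ring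
      rw [hqr, div_eq_mul_one_div]
    · rw [div_eq_mul_inv]
      refine mul_le_mul (abs_coprW_le_mul hα hβ Xm Xn (q * r)) ?_ (inv_nonneg.2 (Nat.cast_nonneg _))
        (by positivity)
      calc ((Nat.totient (q * r) : ℝ))⁻¹ ≤ (σ 0 q : ℝ) * (σ 0 r : ℝ) / ((q : ℝ) * r) :=
            inv_totient_mul_le hq0 hr0
        _ = (σ 0 q : ℝ) * (σ 0 r : ℝ) * (1 / ((q : ℝ) * r)) := by rw [← div_eq_mul_one_div]
        _ ≤ Cσ * X ^ δ * (1 / ((q : ℝ) * r)) :=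
            mul_le_mul_of_nonneg_right (hστ r hrR q hq'.1) (by positivity)
  -- Step 1: reduce to the sum of the pointwise bounds over the unfiltered sets
  have h1 : tripleTS a Xm Xn Xq α β γ SL SR ≤ ∑ r ∈ SR, ∑ _l ∈ SL, ∑ q ∈ TQ, bd r q := by
    unfold tripleTS
    calc _ ≤ ∑ r ∈ SR.filter (fun r : ℕ => IsCoprime (r : ℤ) a), ∑ l ∈ SL.filter (fun l : ℕ => l.Coprime r),
          ∑ q ∈ TQ.filter (fun q : ℕ => IsCoprime (q : ℤ) (a * l)), bd r q := by
          refine Finset.sum_le_sum fun r hr => Finset.sum_le_sum fun l hl => ?_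
          unfold qSumT
          calc |∑ q ∈ (Icc 1 Xq).filter (fun q : ℕ => IsCoprime (q : ℤ) (a * l)), γ q * bracketT a Xm Xn α β l (q * r)|
              ≤ ∑ q ∈ (Icc 1 Xq).filter (fun q : ℕ => IsCoprime (q : ℤ) (a * l)),
                  |γ q * bracketT a Xm Xn α β l (q * r)| := Finset.abs_sum_le_sum_abs _ _
            _ = ∑ q ∈ TQ.filter (fun q : ℕ => IsCoprime (q : ℤ) (a * l)),
                  |γ q * bracketT a Xm Xn α β l (q * r)| := by
                have hset : TQ.filter (fun q : ℕ => IsCoprime (q : ℤ) (a * l)) =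
                    ((Icc 1 Xq).filter (fun q : ℕ => IsCoprime (q : ℤ) (a * l))).filter (fun q : ℕ => q ∈ T) := by
                  ext q; simp only [hTQdef, Finset.mem_filter]; tauto
                rw [hset, Finset.sum_filter (p := fun q : ℕ => q ∈ T)]
                refine Finset.sum_congr rfl fun q _ => ?_
                by_cases hq : q ∈ T
                · rw [if_pos hq]
                · rw [if_neg hq]
                  have : γ q = 0 := by by_contra h; exact hq (hγT q h)
                  rw [this, zero_mul, abs_zero]
            _ ≤ _ := Finset.sum_le_sum fun q hq => ?_
          rw [abs_mul]
          calc |γ q| * |bracketT a Xm Xn α β l (q * r)| ≤ 1 * |bracketT a Xm Xn α β l (q * r)| :=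
                mul_le_mul_of_nonneg_right (hγ q) (abs_nonneg _)
            _ = |congrW a Xm Xn α β l (q * r) - coprW Xm Xn α β (q * r) / (Nat.totient (q * r) : ℝ)| := by
                rw [one_mul]; rfl
            _ ≤ |congrW a Xm Xn α β l (q * r)| + |coprW Xm Xn α β (q * r) / (Nat.totient (q * r) : ℝ)| :=
                abs_sub _ _
            _ = |congrW a Xm Xn α β l (q * r)| + |coprW Xm Xn α β (q * r)| / (Nat.totient (q * r) : ℝ) := by
                rw [abs_div, Nat.abs_cast]
            _ ≤ bd r q := hpt r hr l hl q hq
      _ ≤ ∑ r ∈ SR.filter (fun r : ℕ => IsCoprime (r : ℤ) a), ∑ l ∈ SL.filter (fun l : ℕ => l.Coprime r),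
          ∑ q ∈ TQ, bd r q :=
          Finset.sum_le_sum fun r _ => Finset.sum_le_sum fun l _ =>
            Finset.sum_le_sum_of_subset_of_nonneg (Finset.filter_subset _ _) fun q _ _ => hbd0 r q
      _ ≤ ∑ r ∈ SR.filter (fun r : ℕ => IsCoprime (r : ℤ) a), ∑ _l ∈ SL, ∑ q ∈ TQ, bd r q :=
          Finset.sum_le_sum fun r _ => Finset.sum_le_sum_of_subset_of_nonneg (Finset.filter_subset _ _)
            fun l _ _ => Finset.sum_nonneg fun q _ => hbd0 r q
      _ ≤ _ := Finset.sum_le_sum_of_subset_of_nonneg (Finset.filter_subset _ _) fun r _ _ =>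
            Finset.sum_nonneg fun l _ => Finset.sum_nonneg fun q _ => hbd0 r q
  refine h1.trans ?_
  -- Step 2: evaluate the sum of the bounds
  have hK : ((Xm * Xn : ℕ) : ℝ) = (Xm : ℝ) * Xn := by push_cast; ring
  rw [show ∑ r ∈ SR, ∑ _l ∈ SL, ∑ q ∈ TQ, bd r q = (SL.card : ℝ) * ∑ r ∈ SR, ∑ q ∈ TQ, bd r q by
    rw [Finset.mul_sum]
    refine Finset.sum_congr rfl fun r _ => ?_
    rw [Finset.sum_const, nsmul_eq_mul]]
  have hsum : ∑ r ∈ SR, ∑ q ∈ TQ, bd r q =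
      (Cp * X ^ δ + Cσ * X ^ δ) * ((Xm : ℝ) * Xn) * ∑ r ∈ SR, ∑ q ∈ TQ, (1 / ((q : ℝ) * r)) +
        Cp * X ^ δ * (SR.card * TQ.card) := by
    have hb : ∀ r q : ℕ, bd r q =
        ((Cp * X ^ δ + Cσ * X ^ δ) * ((Xm : ℝ) * Xn)) * (1 / ((q : ℝ) * r)) + Cp * X ^ δ := by
      intro r q; simp only [hbd, hK]; ring
    calc ∑ r ∈ SR, ∑ q ∈ TQ, bd r q
        = ∑ r ∈ SR, ∑ q ∈ TQ, (((Cp * X ^ δ + Cσ * X ^ δ) * ((Xm : ℝ) * Xn)) * (1 / ((q : ℝ) * r)) + Cp * X ^ δ) :=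
          Finset.sum_congr rfl fun r _ => Finset.sum_congr rfl fun q _ => hb r q
      _ = ∑ r ∈ SR, ((∑ q ∈ TQ, ((Cp * X ^ δ + Cσ * X ^ δ) * ((Xm : ℝ) * Xn)) * (1 / ((q : ℝ) * r))) +
            (TQ.card : ℝ) * (Cp * X ^ δ)) := by
          refine Finset.sum_congr rfl fun r _ => ?_
          rw [Finset.sum_add_distrib, Finset.sum_const, nsmul_eq_mul]
      _ = _ := by
          rw [Finset.sum_add_distrib, Finset.sum_const, nsmul_eq_mul, Finset.mul_sum]
          congr 1
          · exact Finset.sum_congr rfl fun r _ => by rw [Finset.mul_sum]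
          · ring
  rw [hsum]
  have hXδ : 0 ≤ X ^ δ := Real.rpow_nonneg hX0.le δ
  have hmain : (Cp * X ^ δ + Cσ * X ^ δ) * ((Xm : ℝ) * Xn) * ∑ r ∈ SR, ∑ q ∈ TQ, (1 / ((q : ℝ) * r)) ≤
      (Cp * X ^ δ + Cσ * X ^ δ) * ((Xm : ℝ) * Xn) * (2 * (T.card / Q₀)) :=
    mul_le_mul_of_nonneg_left hinvqr (by positivity)
  have hplus : Cp * X ^ δ * ((SR.card : ℝ) * TQ.card) ≤ Cp * X ^ δ * ((2 * R + 1) * T.card) := by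
    refine mul_le_mul_of_nonneg_left ?_ (by positivity)
    exact mul_le_mul hSRcard hTQcard (Nat.cast_nonneg _) (by positivity)
  have hSL0 : (0 : ℝ) ≤ SL.card := Nat.cast_nonneg _
  calc (SL.card : ℝ) * ((Cp * X ^ δ + Cσ * X ^ δ) * ((Xm : ℝ) * Xn) * ∑ r ∈ SR, ∑ q ∈ TQ, (1 / ((q : ℝ) * r)) +
        Cp * X ^ δ * (SR.card * TQ.card))
      ≤ (SL.card : ℝ) * ((Cp * X ^ δ + Cσ * X ^ δ) * ((Xm : ℝ) * Xn) * (2 * (T.card / Q₀)) +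
          Cp * X ^ δ * ((2 * R + 1) * T.card)) := mul_le_mul_of_nonneg_left (add_le_add hmain hplus) hSL0
    _ = (2 * Cp + 2 * Cσ) * X ^ δ * SL.card * (T.card / Q₀ * (Xm * Xn) + T.card * (2 * R + 1)) -
          (Cp + 2 * Cσ) * X ^ δ * SL.card * (T.card * (2 * R + 1)) := by ring
    _ ≤ (2 * Cp + 2 * Cσ) * X ^ δ * SL.card * (T.card / Q₀ * (Xm * Xn) + T.card * (2 * R + 1)) := by
        have : 0 ≤ (Cp + 2 * Cσ) * X ^ δ * SL.card * (T.card * (2 * R + 1)) := by positivity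
        linarith

/-! ### The smoothing step over sets -/

/-- **The smoothing step with cardinalities, over sets** (as `tripleT_indicator_le_smooth_card`
with `#SL` in place of `2L + 1` and `#SR ≤ 2R + 1`): the three errors of replacing the indicators of
`m ∼ M`, `n ∼ N`, `q ∼ Q` by plateau bumps are bounded by the thin-weight bounds.
[cite: BombieriFriedlanderIwaniecActa1986, §14 p. 244–245] -/
theorem tripleTS_indicator_le_smooth_card {δ : ℝ} (hδ : 0 < δ) :
    ∃ C : ℝ, 0 < C ∧ ∀ (a : ℤ) (Xm Xn Xq Xl : ℕ) (SL SR : Finset ℕ) (M N Q YM YN YQ R X : ℝ),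
      0 < YM → YM ≤ M → 0 < YN → YN ≤ N → 0 < YQ → YQ ≤ Q / 2 →
      0 ≤ R → 1 ≤ X → (Xm : ℝ) ≤ X → (Xn : ℝ) ≤ X → (Xq : ℝ) ≤ X → (Xl : ℝ) ≤ X → R ≤ X →
      SL ⊆ Icc 1 Xl → SR ⊆ dyadic R →
      |(a : ℝ)| ≤ X → (∀ m ∈ bumpDiffSupport M YM, a < (m : ℤ)) → (∀ n ∈ bumpDiffSupport N YN, a < (n : ℤ)) →
      tripleTS a Xm Xn Xq (ind (dyadic M)) (ind (dyadic N)) (ind (dyadic Q)) SL SR ≤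
        tripleTS a Xm Xn Xq (bumpW M YM) (bumpW N YN) (bumpW Q YQ) SL SR +
          C * X ^ δ * SL.card * (((bumpDiffSupport M YM).card : ℝ) * Xn +
            ((bumpDiffSupport N YN).card : ℝ) * Xm +
            (((bumpDiffSupport Q YQ).card : ℝ) / (Q / 2) * (Xm * Xn) +
              ((bumpDiffSupport Q YQ).card : ℝ) * (2 * R + 1))) := by
  obtain ⟨C₁, hC₁, h₁⟩ := tripleTS_le_of_thin_alpha hδ
  obtain ⟨C₃, hC₃, h₃⟩ := tripleTS_le_of_thin_gamma hδ
  refine ⟨max C₁ C₃ * 2 ^ δ, by positivity, ?_⟩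
  intro a Xm Xn Xq Xl SL SR M N Q YM YN YQ R X hYM0 hYM hYN0 hYN hYQ0 hYQ hR hX hXm hXn hXq hXl hRX
    hSL hSR haX haM haN
  have hM : 0 ≤ M := hYM0.le.trans hYM
  have hN : 0 ≤ N := hYN0.le.trans hYN
  have hQ0 : 0 < Q := by linarith
  have hYQ' : YQ ≤ Q := by linarith
  have hX0 : 0 < X := by linarith
  have hXδ : 0 ≤ X ^ δ := Real.rpow_nonneg hX0.le δ
  have hSR' : SR ⊆ Icc 1 ⌊2 * R⌋₊ := hSR.trans (dyadic_subset_Icc hR)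
  have hXr : ((⌊2 * R⌋₊ : ℕ) : ℝ) ≤ 2 * X := (Nat.floor_le (by positivity)).trans (by linarith)
  -- thin-α with `X' = 2X`
  have hX2 : 1 ≤ 2 * X := by linarith
  refine (tripleTS_indicator_le_split a Xm Xn Xq (bumpW M YM) (bumpW N YN) (bumpW Q YQ)
    (dyadic M) (dyadic N) (dyadic Q) SL SR).trans ?_
  have hbM : ∀ m, |bumpW M YM m| ≤ 1 := abs_bumpW_le_one hYM0 hM
  have hbN : ∀ n, |bumpW N YN n| ≤ 1 := abs_bumpW_le_one hYN0 hN
  have hiN : ∀ n, |ind (dyadic N) n| ≤ 1 := abs_ind_le_one _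
  have hiQ : ∀ q, |ind (dyadic Q) q| ≤ 1 := abs_ind_le_one _
  have h2X : ∀ {t : ℝ}, t ≤ X → t ≤ 2 * X := fun h => h.trans (by linarith)
  have haX2 : |(a : ℝ)| ≤ 2 * X := h2X haX
  have hE1 : tripleTS a Xm Xn Xq (bumpW M YM - ind (dyadic M)) (ind (dyadic N)) (ind (dyadic Q)) SL SR ≤
      C₁ * (2 * X) ^ δ * (bumpDiffSupport M YM).card * SL.card * Xn :=
    h₁ a Xm Xn Xq Xl ⌊2 * R⌋₊ (bumpDiffSupport M YM) SL SR _ _ _ (2 * X) hX2 (h2X hXm) (h2X hXn) (h2X hXq)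
      (h2X hXl) hXr hSL hSR' haX2 haM
      (abs_bumpW_sub_ind_le_one hYM0 hM) (fun m hm => mem_bumpDiffSupport_of_ne hYM0 hYM hm) hiN hiQ
  have hE2 : tripleTS a Xm Xn Xq (bumpW M YM) (bumpW N YN - ind (dyadic N)) (ind (dyadic Q)) SL SR ≤
      C₁ * (2 * X) ^ δ * (bumpDiffSupport N YN).card * SL.card * Xm := by
    rw [tripleTS_swap]
    exact h₁ a Xn Xm Xq Xl ⌊2 * R⌋₊ (bumpDiffSupport N YN) SL SR _ _ _ (2 * X) hX2 (h2X hXn) (h2X hXm)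
      (h2X hXq) (h2X hXl) hXr hSL hSR' haX2 haN
      (abs_bumpW_sub_ind_le_one hYN0 hN) (fun n hn => mem_bumpDiffSupport_of_ne hYN0 hYN hn) hbM hiQ
  have hE3 : tripleTS a Xm Xn Xq (bumpW M YM) (bumpW N YN) (bumpW Q YQ - ind (dyadic Q)) SL SR ≤
      C₃ * X ^ δ * SL.card * ((bumpDiffSupport Q YQ).card / (Q / 2) * (Xm * Xn) +
        (bumpDiffSupport Q YQ).card * (2 * R + 1)) :=
    h₃ a Xm Xn Xq Xl (bumpDiffSupport Q YQ) SL SR _ _ _ X R (Q / 2) hX hXm hXn hXq hXl hR hRX hSL hSR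
      (by positivity)
      (fun q hq => by
        have h := lt_of_mem_bumpDiffSupport hYQ0.le hYQ' hq
        linarith)
      hbM hbN (abs_bumpW_sub_ind_le_one hYQ0 hQ0.le) (fun q hq => mem_bumpDiffSupport_of_ne hYQ0 hYQ' hq)
  -- `(2X)^δ ≤ 2 X^δ`
  have h2δ : (2 * X) ^ δ ≤ 2 ^ δ * X ^ δ := by rw [Real.mul_rpow (by norm_num) hX0.le]
  set C := max C₁ C₃ with hC
  have hC₁' : C₁ ≤ C := le_max_left _ _
  have hC₃' : C₃ ≤ C := le_max_right _ _
  have hF1 : C₁ * (2 * X) ^ δ * (bumpDiffSupport M YM).card * SL.card * Xn ≤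
      (C * 2 ^ δ) * X ^ δ * SL.card * (((bumpDiffSupport M YM).card : ℝ) * Xn) := by
    have h0 : 0 ≤ ((bumpDiffSupport M YM).card : ℝ) * SL.card * Xn := by positivity
    calc C₁ * (2 * X) ^ δ * (bumpDiffSupport M YM).card * SL.card * Xn
        = C₁ * (2 * X) ^ δ * (((bumpDiffSupport M YM).card : ℝ) * SL.card * Xn) := by ring
      _ ≤ C * (2 ^ δ * X ^ δ) * (((bumpDiffSupport M YM).card : ℝ) * SL.card * Xn) := by
          gcongr
      _ = (C * 2 ^ δ) * X ^ δ * SL.card * (((bumpDiffSupport M YM).card : ℝ) * Xn) := by ring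
  have hF2 : C₁ * (2 * X) ^ δ * (bumpDiffSupport N YN).card * SL.card * Xm ≤
      (C * 2 ^ δ) * X ^ δ * SL.card * (((bumpDiffSupport N YN).card : ℝ) * Xm) := by
    calc C₁ * (2 * X) ^ δ * (bumpDiffSupport N YN).card * SL.card * Xm
        = C₁ * (2 * X) ^ δ * (((bumpDiffSupport N YN).card : ℝ) * SL.card * Xm) := by ring
      _ ≤ C * (2 ^ δ * X ^ δ) * (((bumpDiffSupport N YN).card : ℝ) * SL.card * Xm) := by
          gcongr
      _ = (C * 2 ^ δ) * X ^ δ * SL.card * (((bumpDiffSupport N YN).card : ℝ) * Xm) := by ring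
  have h12 : (1 : ℝ) ≤ 2 ^ δ := Real.one_le_rpow (by norm_num) hδ.le
  have hF3 : C₃ * X ^ δ * SL.card * ((bumpDiffSupport Q YQ).card / (Q / 2) * (Xm * Xn) +
        (bumpDiffSupport Q YQ).card * (2 * R + 1)) ≤
      (C * 2 ^ δ) * X ^ δ * SL.card * ((bumpDiffSupport Q YQ).card / (Q / 2) * (Xm * Xn) +
        (bumpDiffSupport Q YQ).card * (2 * R + 1)) := by
    have h0 : 0 ≤ X ^ δ * SL.card * ((bumpDiffSupport Q YQ).card / (Q / 2) * (Xm * Xn) +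
        (bumpDiffSupport Q YQ).card * (2 * R + 1)) := by positivity
    have hCC : C₃ ≤ C * 2 ^ δ := hC₃'.trans (by nlinarith [le_max_left C₁ C₃, hC₁.le])
    calc _ = C₃ * (X ^ δ * SL.card * ((bumpDiffSupport Q YQ).card / (Q / 2) * (Xm * Xn) +
          (bumpDiffSupport Q YQ).card * (2 * R + 1))) := by ring
      _ ≤ (C * 2 ^ δ) * (X ^ δ * SL.card * ((bumpDiffSupport Q YQ).card / (Q / 2) * (Xm * Xn) +
          (bumpDiffSupport Q YQ).card * (2 * R + 1))) := mul_le_mul_of_nonneg_right hCC h0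
      _ = _ := by ring
  have key := add_le_add (add_le_add (hE1.trans hF1) (hE2.trans hF2)) (hE3.trans hF3)
  linarith [key]

/-! ### The Poisson step over sets -/

/-- The oscillatory triple sum over sets `SL`, `SR`:
`∑_{r ∈ SR, (r,a)=1} ∑_{l ∈ SL, (l,r)=1} |oscQ(r, l)|`. [cite: BombieriFriedlanderIwaniecActa1986, §14 p. 245] -/
def tripleOscS (a : ℤ) (M Y : ℝ) (H₀ Xn Xq : ℕ) (β γ : ℕ → ℝ) (SL SR : Finset ℕ) : ℝ :=
  ∑ r ∈ SR.filter (fun r : ℕ => IsCoprime (r : ℤ) a),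
    ∑ l ∈ SL.filter (fun l : ℕ => l.Coprime r), |oscQ a M Y H₀ Xn Xq β γ r l|

/-- `tripleOscS ≥ 0`. [folklore] -/
theorem tripleOscS_nonneg (a : ℤ) (M Y : ℝ) (H₀ Xn Xq : ℕ) (β γ : ℕ → ℝ) (SL SR : Finset ℕ) :
    0 ≤ tripleOscS a M Y H₀ Xn Xq β γ SL SR :=
  Finset.sum_nonneg fun _ _ => Finset.sum_nonneg fun _ _ => abs_nonneg _

/-- **The Poisson step over sets** (as `tripleT_bumpW_le_osc`):
`Δ(bump_M, β, γ; SL, SR) ≤ tripleOscS + Xn · ∑_{r ∈ SR} ∑_{l ∈ SL} ∑_{q ≤ Xq} errP(qr)`.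
[cite: BombieriFriedlanderIwaniecActa1986, §14 (14.2)–(14.3) p. 245] -/
theorem tripleTS_bumpW_le_oscS {a : ℤ} {M Y : ℝ} (hY : 0 < Y) (hYM : Y ≤ M) {Xm : ℕ}
    (hXm : ⌊2 * M + Y⌋₊ ≤ Xm) (Xn Xq : ℕ) {β γ : ℕ → ℝ} (hβ : ∀ n, |β n| ≤ 1) (hγ : ∀ q, |γ q| ≤ 1)
    (H₀ : ℕ) {j : ℕ} (hj : 2 ≤ j) (K : ℕ → ℕ) {SL SR : Finset ℕ} (hSR0 : ∀ r ∈ SR, 0 < r) :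
    tripleTS a Xm Xn Xq (bumpW M Y) β γ SL SR ≤
      tripleOscS a M Y H₀ Xn Xq β γ SL SR +
        (Xn : ℝ) * ∑ r ∈ SR, ∑ _l ∈ SL, ∑ q ∈ Icc 1 Xq, errP M Y H₀ j K (q * r) := by
  have hM : 0 ≤ M := hY.le.trans hYM
  have hβsum : ∑ n ∈ Icc 1 Xn, |β n| ≤ Xn := by
    calc ∑ n ∈ Icc 1 Xn, |β n| ≤ ∑ _n ∈ Icc 1 Xn, (1 : ℝ) := Finset.sum_le_sum fun n _ => hβ n
      _ = Xn := by simp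
  have herr0 : ∀ k, 0 ≤ errP M Y H₀ j K k := fun k => errP_nonneg M hY hM H₀ j K k
  set E : ℕ → ℝ := fun r => (Xn : ℝ) * ∑ q ∈ Icc 1 Xq, errP M Y H₀ j K (q * r) with hE
  have hE0 : ∀ r, 0 ≤ E r := fun r => mul_nonneg (Nat.cast_nonneg _) (Finset.sum_nonneg fun q _ => herr0 _)
  -- Step A: termwise, `|qSumT| ≤ |oscQ| + E r`
  have hA : ∀ r ∈ SR.filter (fun r : ℕ => IsCoprime (r : ℤ) a),
      ∀ l ∈ SL.filter (fun l : ℕ => l.Coprime r),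
        |qSumT a Xm Xn Xq (bumpW M Y) β γ r l| ≤ |oscQ a M Y H₀ Xn Xq β γ r l| + E r := by
    intro r hr l hl
    have hr' := Finset.mem_filter.1 hr
    have hl' := Finset.mem_filter.1 hl
    have hr0 : 0 < r := hSR0 r hr'.1
    have hdiff : |qSumT a Xm Xn Xq (bumpW M Y) β γ r l - oscQ a M Y H₀ Xn Xq β γ r l| ≤ E r := by
      unfold qSumT oscQ
      rw [← Finset.sum_sub_distrib]
      refine (Finset.abs_sum_le_sum_abs _ _).trans ?_
      calc ∑ q ∈ (Icc 1 Xq).filter (fun q : ℕ => IsCoprime (q : ℤ) (a * l)),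
            |γ q * bracketT a Xm Xn (bumpW M Y) β l (q * r) - γ q * oscBr a M Y H₀ Xn β l (q * r)|
          ≤ ∑ q ∈ (Icc 1 Xq).filter (fun q : ℕ => IsCoprime (q : ℤ) (a * l)),
              (Xn : ℝ) * errP M Y H₀ j K (q * r) := by
            refine Finset.sum_le_sum fun q hq => ?_
            have hq' := Finset.mem_filter.1 hq
            have hq0 : 0 < q := (Finset.mem_Icc.1 hq'.1).1
            obtain ⟨hka, hlk⟩ := coprime_modulus hr'.2 hl'.2 hq'.2
            rw [← mul_sub, abs_mul]
            calc |γ q| * |bracketT a Xm Xn (bumpW M Y) β l (q * r) - oscBr a M Y H₀ Xn β l (q * r)|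
                ≤ 1 * ((∑ n ∈ Icc 1 Xn, |β n|) * errP M Y H₀ j K (q * r)) :=
                  mul_le_mul (hγ q) (abs_bracketT_bumpW_sub_le hY hYM hXm Xn β (Nat.mul_pos hq0 hr0)
                    hka hlk H₀ hj K) (abs_nonneg _) zero_le_one
              _ ≤ (Xn : ℝ) * errP M Y H₀ j K (q * r) := by
                  rw [one_mul]
                  exact mul_le_mul_of_nonneg_right hβsum (herr0 _)
        _ ≤ ∑ q ∈ Icc 1 Xq, (Xn : ℝ) * errP M Y H₀ j K (q * r) :=
            Finset.sum_le_sum_of_subset_of_nonneg (Finset.filter_subset _ _) fun q _ _ =>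
              mul_nonneg (Nat.cast_nonneg _) (herr0 _)
        _ = E r := by simp only [hE]; rw [Finset.mul_sum]
    have := abs_sub_abs_le_abs_sub (qSumT a Xm Xn Xq (bumpW M Y) β γ r l) (oscQ a M Y H₀ Xn Xq β γ r l)
    linarith
  -- Steps B–D
  unfold tripleTS tripleOscS
  calc ∑ r ∈ SR.filter (fun r : ℕ => IsCoprime (r : ℤ) a),
        ∑ l ∈ SL.filter (fun l : ℕ => l.Coprime r), |qSumT a Xm Xn Xq (bumpW M Y) β γ r l|
      ≤ ∑ r ∈ SR.filter (fun r : ℕ => IsCoprime (r : ℤ) a),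
          ∑ l ∈ SL.filter (fun l : ℕ => l.Coprime r), (|oscQ a M Y H₀ Xn Xq β γ r l| + E r) :=
        Finset.sum_le_sum fun r hr => Finset.sum_le_sum fun l hl => hA r hr l hl
    _ = (∑ r ∈ SR.filter (fun r : ℕ => IsCoprime (r : ℤ) a),
          ∑ l ∈ SL.filter (fun l : ℕ => l.Coprime r), |oscQ a M Y H₀ Xn Xq β γ r l|) +
          ∑ r ∈ SR.filter (fun r : ℕ => IsCoprime (r : ℤ) a),
            ∑ _l ∈ SL.filter (fun l : ℕ => l.Coprime r), E r := by
        rw [← Finset.sum_add_distrib]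
        refine Finset.sum_congr rfl fun r _ => ?_
        rw [Finset.sum_add_distrib]
    _ ≤ (∑ r ∈ SR.filter (fun r : ℕ => IsCoprime (r : ℤ) a),
          ∑ l ∈ SL.filter (fun l : ℕ => l.Coprime r), |oscQ a M Y H₀ Xn Xq β γ r l|) +
          ∑ r ∈ SR, ∑ _l ∈ SL, E r := by
        gcongr ?_ + ?_
        · exact le_rfl
        calc ∑ r ∈ SR.filter (fun r : ℕ => IsCoprime (r : ℤ) a),
              ∑ _l ∈ SL.filter (fun l : ℕ => l.Coprime r), E r
            ≤ ∑ r ∈ SR.filter (fun r : ℕ => IsCoprime (r : ℤ) a), ∑ _l ∈ SL, E r :=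
              Finset.sum_le_sum fun r _ => Finset.sum_le_sum_of_subset_of_nonneg (Finset.filter_subset _ _)
                fun l _ _ => hE0 r
          _ ≤ ∑ r ∈ SR, ∑ _l ∈ SL, E r :=
              Finset.sum_le_sum_of_subset_of_nonneg (Finset.filter_subset _ _) fun r _ _ =>
                Finset.sum_nonneg fun l _ => hE0 r
    _ = _ := by
        congr 1
        rw [hE, Finset.mul_sum]
        refine Finset.sum_congr rfl fun r _ => ?_
        rw [Finset.mul_sum]


/-- **The Poisson errors summed over sets** (as `sum_errP_le`, with `#SL` in place of `2L+1` and
`SR ⊆ [1, 2R]`). [cite: BombieriFriedlanderIwaniecActa1986, §12 p. 236; §14 (14.3) p. 245] -/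
theorem sum_errP_le_sets {x M Q R ε₁ : ℝ} (hx : 1 ≤ x) (hM1 : 1 ≤ M) (hMx : M ≤ x) (hQ : 0 < Q) (hR : 0 < R)
    (hQR : 2 * Q * R < x) (hε₁ : 0 < ε₁) {j : ℕ} (hj : 1 ≤ j) (hjε : 2 + 2 * ε₁ ≤ j * ε₁)
    {Xq : ℕ} (hXq : (Xq : ℝ) ≤ 4 * Q) {SL SR : Finset ℕ} (hSR : SR ⊆ Icc 1 ⌊2 * R⌋₊) :
    ∑ r ∈ SR, ∑ _l ∈ SL, ∑ q ∈ Icc 1 Xq,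
        errP M (M * x ^ (-ε₁)) ⌊x ^ (2 * ε₁) * (2 * Q) * R / M⌋₊ j
          (fun d => ⌊(d : ℝ) * x ^ (ε₁ / 2) / (M * x ^ (-ε₁))⌋₊) (q * r) ≤
      (SL.card : ℝ) * (118 * derivConst j * x ^ (3 * ε₁ / 2)) *
        ∑ q ∈ Icc 1 Xq, ∑ r ∈ Icc 1 ⌊2 * R⌋₊, (σ 0 (q * r) : ℝ) / (Nat.totient (q * r) : ℝ) := by
  have hx0 : 0 < x := by linarith
  set c : ℝ := 118 * derivConst j * x ^ (3 * ε₁ / 2) with hc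
  have hc0 : 0 ≤ c := by have := one_le_derivConst j; positivity
  have hone : ∀ r ∈ Icc 1 ⌊2 * R⌋₊, ∀ q ∈ Icc 1 Xq,
      errP M (M * x ^ (-ε₁)) ⌊x ^ (2 * ε₁) * (2 * Q) * R / M⌋₊ j
          (fun d => ⌊(d : ℝ) * x ^ (ε₁ / 2) / (M * x ^ (-ε₁))⌋₊) (q * r) ≤
        c * ((σ 0 (q * r) : ℝ) / (Nat.totient (q * r) : ℝ)) := by
    intro r hr q hq
    have hr' := Finset.mem_Icc.1 hr
    have hq' := Finset.mem_Icc.1 hq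
    have hr2 : (r : ℝ) ≤ 2 * R := by
      have : (r : ℝ) ≤ ⌊2 * R⌋₊ := by exact_mod_cast hr'.2
      exact this.trans (Nat.floor_le (by linarith))
    have hq4 : (q : ℝ) ≤ 4 * Q := le_trans (by exact_mod_cast hq'.2) hXq
    have hk8 : ((q * r : ℕ) : ℝ) ≤ 8 * Q * R := by
      push_cast
      have hq0 : (0 : ℝ) ≤ q := Nat.cast_nonneg q
      calc (q : ℝ) * r ≤ (4 * Q) * (2 * R) := mul_le_mul hq4 hr2 (Nat.cast_nonneg r) (by positivity)
        _ = 8 * Q * R := by ring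
    exact errP_le hx hM1 hMx hQ hR hQR hε₁ hj hjε (Nat.mul_pos hq'.1 hr'.1) hk8
  have hσφ0 : ∀ q r : ℕ, 0 ≤ (σ 0 (q * r) : ℝ) / (Nat.totient (q * r) : ℝ) := fun q r => by positivity
  calc ∑ r ∈ SR, ∑ _l ∈ SL, ∑ q ∈ Icc 1 Xq,
        errP M (M * x ^ (-ε₁)) ⌊x ^ (2 * ε₁) * (2 * Q) * R / M⌋₊ j
          (fun d => ⌊(d : ℝ) * x ^ (ε₁ / 2) / (M * x ^ (-ε₁))⌋₊) (q * r)
      ≤ ∑ r ∈ Icc 1 ⌊2 * R⌋₊, ∑ _l ∈ SL, ∑ q ∈ Icc 1 Xq,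
          c * ((σ 0 (q * r) : ℝ) / (Nat.totient (q * r) : ℝ)) := by
        calc _ ≤ ∑ r ∈ SR, ∑ _l ∈ SL, ∑ q ∈ Icc 1 Xq,
              c * ((σ 0 (q * r) : ℝ) / (Nat.totient (q * r) : ℝ)) :=
              Finset.sum_le_sum fun r hr => Finset.sum_le_sum fun l _ => Finset.sum_le_sum fun q hq =>
                hone r (hSR hr) q hq
          _ ≤ _ := Finset.sum_le_sum_of_subset_of_nonneg hSR fun r _ _ =>
              Finset.sum_nonneg fun l _ => Finset.sum_nonneg fun q _ => mul_nonneg hc0 (hσφ0 q r)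
    _ = (SL.card : ℝ) * (c * ∑ r ∈ Icc 1 ⌊2 * R⌋₊, ∑ q ∈ Icc 1 Xq,
          ((σ 0 (q * r) : ℝ) / (Nat.totient (q * r) : ℝ))) := by
        simp_rw [Finset.mul_sum]
        refine Finset.sum_congr rfl fun r _ => ?_
        rw [Finset.sum_const, nsmul_eq_mul, Finset.mul_sum]
    _ = _ := by rw [Finset.sum_comm]; ring


end BFI

end Literature.NumberTheory.Sieve
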